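import Summits.AtomisticToContinuum.Crystallization.Theorems.ChargedEnergyGapCoolGuardDial
import Summits.AtomisticToContinuum.Crystallization.Theorems.PricedLinkCensusChargedEnergyGapChargeRecount
import HarnessLib

/-!
# `ChargedEnergyGap` — the cool guard, companion: discharging `ChargeRecount` from the tree
# (cell `decomp-a2c`, lens 3, generation 48, node «CoolGuard», part K-A′)

`…ChargedEnergyGapCoolGuard.ChargeRecount` is VERBATIM the statement of the tree theorem
`BarlowRelativePricingRecount.stub_chargeRecount` (`Theorems/PricedLinkCensusChargedEnergyGapChargeRecount.lean`, PROVED,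
`F = 812`).  It is carried as a named hypothesis in parts K-A / K-B only because the farm build of that module was stale when K-A
was checked (2026-09-01, `remote:stale:…:unbuilt:…ChargeRecount`); this three-theorem file discharges it and states the
record translation and the record guarded node UNCONDITIONALLY.  (UNCHECKED on the farm for the same reason; it elaborates as
soon as the `…ChargeRecount` olean is rebuilt — the proof terms are definitional.)
-/

noncomputable section

open Summit.AtomisticToContinuum.Crystallization.Theses.PricedLinkCensus

namespace Summit.AtomisticToContinuum.Crystallization.Theorems.ChargedEnergyGapChartDial

/-- The tree's charge recount (`stub_chargeRecount`, `F = 812`) IS `ChargeRecount`. [folklore] -/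
theorem chargeRecount : ChargeRecount := BarlowRelativePricingRecount.stub_chargeRecount

/-- ★★ RECORD translation, unconditional: `ChargedEnergyGap ↔ ∃ κ > 0, GuardedPricing (1/10) (1/3) κ`. -/
theorem chargedEnergyGap_iff_guardedPricing_record' :
    ChargedEnergyGap ↔ ∃ κ : ℝ, 0 < κ ∧ GuardedPricing (1 / 10) (1 / 3) κ :=
  chargedEnergyGap_iff_guardedPricing_record chargeRecount

/-- ★★ RECORD guarded node, unconditional: `ChargedEnergyGap ↔ GrossChargeGapG (3/20) (1/10) (1/3) ∧
ChartedChargePricingG (3/20) (1/10) (1/3)`. -/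
theorem chargedEnergyGap_iff_piecesG_record' :
    ChargedEnergyGap ↔ GrossChargeGapG (3 / 20) (1 / 10) (1 / 3) ∧ ChartedChargePricingG (3 / 20) (1 / 10) (1 / 3) :=
  chargedEnergyGap_iff_piecesG_record chargeRecount

end Summit.AtomisticToContinuum.Crystallization.Theorems.ChargedEnergyGapChartDial

end
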